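import Summits.BirchSwinnertonDyer.BirchSwinnertonDyer.Theorems.SylvesterTwoHeegnerIndexCoupledTelescopeLevelData
import Summits.BirchSwinnertonDyer.BirchSwinnertonDyer.Theorems.SylvesterTwoHeegnerIndexCoupledTelescopeSelmerAway
import Summits.BirchSwinnertonDyer.BirchSwinnertonDyer.Theorems.SylvesterTwoHeegnerIndexCoupledTelescopeKolyvaginLevelTrivial
import Summits.BirchSwinnertonDyer.BirchSwinnertonDyer.Theorems.SylvesterTwoHeegnerIndexCMFlipBlockOne
import Summits.BirchSwinnertonDyer.BirchSwinnertonDyer.Theorems.SylvesterTwoHeegnerIndexCoupledTelescopeFrobFix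
import Literature.NumberTheory.EllipticCurves.HeegnerPointsKolyvaginPrimaryCongruenceProofs
import HarnessLib

/-!
# The COUPLED Cassels–Tate telescope, XLIV: the rows' CLASS SYSTEM `c_A, c_B : ℕ → H¹` at the level `4^κ` over ALL
# square-free conductors (RESIDUE c v3 (T-L1) class term; crux `UpperOffV0HSYPlus`, stmt-BirchSwinnertonDyer-19804)

Planner D727/D732 (A).  For the display's level `nl = 2^κ·2^κ`, a Kolyvagin-prime predicate `Kol` of (T3-II)'s shape,
and GIVEN global choices (coherent embeddings `emb`, fixers `N`, CM points `y`, coherent generators `σ` of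
`…ClassSystemChoices`; the pinned frame transport `κ₉`; the coupled frame of `exists_coupledFrame`; the bottom
transversal `t` of `Γ_K/N₀`), this file DEFINES (inside one ∃, by their defining equations — the interface the
SIGNS/(T-L2)′/final assemblers consume) the classes
`c_A(n) = c(ψ_A(Σᵢ ρ²_{tᵢ}(tᵢ • Pt n)))`, `c_B(n) = c(ψ_B(Σᵢ ρ_{tᵢ}(tᵢ • Pt n)))` (`n ∈ KolSupp Kol`, `n ≠ 1` on `B`),
`Pt n = κ₉⁻¹ ιe_n(D_{l(n)} y_n)`, `l(n) = (n.primeFactors.sort (·≤·)).map (q ↦ (σ n q, q))`, and `c_B(1) := 2^{M₀} • x`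
BY DEFINITION (D732 (i)), with their well-formedness from `levelData_sylvesterTower` — and discharges the RESIDUE
clauses that are per-class: l.74 (Kolyvagin primes are inert primes), l.79c (`cB 1 = 2^{M₀} • x`, definitional),
l.100–111 (Selmer-away, (T8)), l.113–120 (the Kolyvagin primes' level, (T5)).  The FLIPs l.87–98 are
`…ClassSystemFlip` (from the same defining equations + (S2b) + the BOTTOM LINK (S3)).
* ★ `exists_classSystem_sylvesterPair`.
Theorems only (no definition / named fact / instance / notation); nothing asserted on 19804; no stub closed;
X12.CMAtTwo NOT proved; BSD not claimed for any curve.  Sources: [GrossLMS1991] §3–§4; [McCallumLMS1991] §4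
Lemma 4.3; [HuShuYin2019] §2, §4.1.  `lean search 'exists_classSystem'` → nothing before this file.
-/

set_option linter.dupNamespace false -- Summits modules are `Summit.<Summit>.<Problem>…` by design
set_option autoImplicit false

noncomputable section

open scoped Classical Pointwise

namespace Summit.BirchSwinnertonDyer.BirchSwinnertonDyer.Theorems.SylvesterTwoCMFlip

open WeierstrassCurve Field NumberField IsDedekindDomain Finset
open Literature.NumberTheory.EllipticCurves Literature.NumberTheory.GaloisRepresentations
  Literature.NumberTheory.EllipticCurves.ModularForms
  Literature.NumberTheory.EllipticCurves.HuShuYin2019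
  Literature.NumberTheory.EllipticCurves.KolyvaginCocycle
  Literature.NumberTheory.EllipticCurves.KolyvaginDescent
  Literature.NumberTheory.EllipticCurves.RingClassField
  Summit.BirchSwinnertonDyer.BirchSwinnertonDyer.Theorems.SylvesterTwoCMData
  Summit.BirchSwinnertonDyer.BirchSwinnertonDyer.Theorems.SylvesterTwoCoupledTelescope
  Summit.BirchSwinnertonDyer.Rank1Residual.X11b
  Summit.BirchSwinnertonDyer.Rank1Residual.X11b.RingClassTower

variable {K : Type} [Field K] [NumberField K]

set_option maxHeartbeats 1600000 in
/-- ★ **THE CLASS SYSTEM at the level `4^κ`** — existence of `c_A, c_B : ℕ → H¹(K, ·[2^κ·2^κ])` with their DEFINING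
EQUATIONS (through the points `Pt n = κ₉⁻¹ ιe_n (D_{l(n)} y_n)`), `c_B 1 = 2^{M₀} • x` by definition, and the per-class
RESIDUE clauses l.74, l.100–111 ((T8)), l.113–120 ((T5)); the global choices are the caller's (binders).
[cite: GrossLMS1991, §3 (3.3)–(3.7), §4 (4.1)–(4.3), Prop. 6.2 (1)] [cite: McCallumLMS1991, §4 Lemma 4.3]
[cite: HuShuYin2019, §2 Prop. 2.4, §4.1] -/
theorem exists_classSystem_sylvesterPair {ω : K} (hω : ω ^ 2 + ω + 1 = 0) (h2 : Module.finrank ℚ K = 2)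
    (ι : K →+* ℂ) (Dt : ModularParametrizationData (⟨0, 0, 1, 0, -1⟩ : WeierstrassCurve ℚ) 243)
    {p : ℕ} (hp : p.Prime) (h9 : p % 9 = 4) (κ : ℕ) (hκ : 1 ≤ κ)
    -- the Kolyvagin-prime predicate, (T3-II)'s shape
    {NA NB : ℕ} (hNA : 3 * p ∣ NA) (hNAc : (cubeSumCurve (3 * (p : ℚ) ^ 2)).conductorNorm ℤ ∣ NA)
    (hNBc : (cubeSumCurve (p : ℚ)).conductorNorm ℤ ∣ NB) (b₀ : ℕ) (Kol : ℕ → Prop)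
    (hKol : ∀ ℓ, Kol ℓ ↔ (ℓ.Prime ∧ ¬ ℓ ∣ NA ∧ ¬ ℓ ∣ NB ∧ ¬ ((ℓ : ℤ) ∣ NumberField.discr K) ∧ ℓ ≠ 2 ∧
      (Ideal.span {(ℓ : 𝓞 K)}).IsPrime ∧ FrobEqFrobInfty (cubeSumCurve (3 * (p : ℚ) ^ 2)) K (2 ^ κ * 2 ^ κ) ℓ ∧
      FrobEqFrobInfty (cubeSumCurve (p : ℚ)) K (2 ^ κ * 2 ^ κ) ℓ ∧ b₀ < ℓ))
    -- the bottom class `2^{M₀} • δ x₀`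
    (M₀ : ℕ) (x₀ : ((cubeSumCurve (p : ℚ)).baseChange K).toAffine.Point)
    -- global choices: coherent embeddings, point maps, fixers, CM points, coherent generators
    (emb : (m : ℕ) → (ringClassField K ι m →+* AlgebraicClosure K))
    (hemb : ∀ (m : ℕ) (k : K), emb m (algebraMap K (ringClassField K ι m) k) = algebraMap K (AlgebraicClosure K) k)
    (hcoh : ∀ (m n : ℕ) (h : ringClassField K ι m ≤ ringClassField K ι n) (x : ringClassField K ι m),
      emb n (RingClassField.inclusion ι h x) = emb m x)
    (ιe : (n : ℕ) → (letI : DecidableEq (ringClassField K ι (9 * p * n)) := fun a b ↦ Classical.propDecidable (a = b)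
      ((⟨0, 0, 1, 0, -1⟩ : WeierstrassCurve ℚ).baseChange (ringClassField K ι (9 * p * n))).toAffine.Point →+
        geomPoints ((⟨0, 0, 1, 0, -1⟩ : WeierstrassCurve ℚ).baseChange K)))
    (hιe : ∀ n P, ιe n P = Affine.Point.map (W' := (⟨0, 0, 1, 0, -1⟩ : WeierstrassCurve ℚ)) (emb (9 * p * n)).toRatAlgHom P)
    (Nf : ℕ → Subgroup (absoluteGaloisGroup K))
    (hNf : ∀ (m : ℕ) (g : absoluteGaloisGroup K), g ∈ Nf m ↔
      ∀ x : ringClassField K ι m, (show AlgebraicClosure K ≃ₐ[K] AlgebraicClosure K from g) (emb m x) = emb m x)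
    (y : (n : ℕ) → ((⟨0, 0, 1, 0, -1⟩ : WeierstrassCurve ℚ).baseChange (ringClassField K ι (9 * p * n))).toAffine.Point)
    (hy : ∀ n, n ≠ 0 → (∀ q ∈ n.primeFactors, q % 3 = 2) →
      Affine.Point.map (W' := (⟨0, 0, 1, 0, -1⟩ : WeierstrassCurve ℚ)) (ringClassField K ι (9 * p * n)).subtype.toRatAlgHom (y n) =
        Dt.φ (heegnerTau ((n : ℤ) ^ 2 * (81 * ((p : ℤ) ^ 2 + 4 * p + 16)),
          (n : ℤ) * (-(9 * (4 * (p : ℤ) ^ 2 + 17 * p + 72))), 4 * (p : ℤ) ^ 2 + 18 * p + 81)))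
    (σ : (n q : ℕ) → (ringClassField K ι (9 * p * n) ≃ₐ[ℚ] ringClassField K ι (9 * p * n)))
    (hσgen : ∀ n q, n ≠ 0 → q.Prime → ¬ q ∣ 9 * p → (Ideal.span {(q : 𝓞 K)}).IsPrime → q ∣ n → ¬ q ∣ n / q →
      Subgroup.zpowers (σ n q) = ringClassGalOver ι (9 * p * n) (9 * p * n / q))
    -- the frame transport `E₉(K̄) ≃+ W₀(K̄)` and the coupled frame (`exists_coupledFrame`)
    (κ₉ : geomPoints ((cubeSumCurve 9).baseChange K) ≃+ geomPoints ((⟨0, 0, 1, 0, -1⟩ : WeierstrassCurve ℚ).baseChange K))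
    (hκG : ∀ (g : absoluteGaloisGroup K) (P : geomPoints ((cubeSumCurve 9).baseChange K)), κ₉ (g • P) = g • κ₉ P)
    {vB vA : AlgebraicClosure K} (hvBc : vB ^ 3 = algebraMap ℚ (AlgebraicClosure K) ((p : ℚ) / 9))
    (hvB : vB ≠ 0) (hvAc : vA ^ 3 = algebraMap ℚ (AlgebraicClosure K) ((p : ℚ) ^ 2 / 3)) (hvA0 : vA ≠ 0)
    (hvB3 : ∀ g : absoluteGaloisGroup K, ((show AlgebraicClosure K ≃ₐ[K] AlgebraicClosure K from g) vB) ^ 3 = vB ^ 3)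
    (hvA3 : ∀ g : absoluteGaloisGroup K, ((show AlgebraicClosure K ≃ₐ[K] AlgebraicClosure K from g) vA) ^ 3 = vA ^ 3)
    {ψB : geomPoints ((cubeSumCurve 9).baseChange K) ≃+ geomPoints ((cubeSumCurve (p : ℚ)).baseChange K)}
    {ψA : geomPoints ((cubeSumCurve 9).baseChange K) ≃+ geomPoints ((cubeSumCurve (3 * (p : ℚ) ^ 2)).baseChange K)}
    (hψB : ∀ {x y : AlgebraicClosure K}
      (h : (((cubeSumCurve 9).baseChange K).baseChange (AlgebraicClosure K)).toAffine.Nonsingular x y),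
      ∃ h', ψB (Affine.Point.some x y h) = Affine.Point.some (vB ^ 2 * x) (vB ^ 3 * y) h')
    (hψA : ∀ {x y : AlgebraicClosure K}
      (h : (((cubeSumCurve 9).baseChange K).baseChange (AlgebraicClosure K)).toAffine.Nonsingular x y),
      ∃ h', ψA (Affine.Point.some x y h) = Affine.Point.some (vA ^ 2 * x) (vA ^ 3 * y) h')
    {ρ : absoluteGaloisGroup K → geomPoints ((cubeSumCurve 9).baseChange K) ≃+ geomPoints ((cubeSumCurve 9).baseChange K)}
    (hρ : ∀ (g : absoluteGaloisGroup K) {x y : AlgebraicClosure K}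
        (h : (((cubeSumCurve 9).baseChange K).baseChange (AlgebraicClosure K)).toAffine.Nonsingular x y),
        ∃ h', ρ g (Affine.Point.some x y h) =
          Affine.Point.some (((show AlgebraicClosure K ≃ₐ[K] AlgebraicClosure K from g) vB / vB) ^ 2 * x) y h')
    (hρρ : ∀ (g : absoluteGaloisGroup K) {x y : AlgebraicClosure K}
        (h : (((cubeSumCurve 9).baseChange K).baseChange (AlgebraicClosure K)).toAffine.Nonsingular x y),
        ∃ h', ρ g (ρ g (Affine.Point.some x y h)) =
          Affine.Point.some (((show AlgebraicClosure K ≃ₐ[K] AlgebraicClosure K from g) vA / vA) ^ 2 * x) y h')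
    (hlawB : ∀ (g : absoluteGaloisGroup K) (P : geomPoints ((cubeSumCurve 9).baseChange K)), g • ψB P = ψB (ρ g (g • P)))
    (hlawA : ∀ (g : absoluteGaloisGroup K) (P : geomPoints ((cubeSumCurve 9).baseChange K)),
        g • ψA P = ψA (ρ g (ρ g (g • P))))
    -- the bottom fixer and transversal (`exists_bottom_transversal` at `emb (9 * p)`)
    (N₀ : Subgroup (absoluteGaloisGroup K))
    (hN₀ : ∀ g : absoluteGaloisGroup K, g ∈ N₀ ↔
      ∀ x : ringClassField K ι (9 * p), (show AlgebraicClosure K ≃ₐ[K] AlgebraicClosure K from g) (emb (9 * p) x) = emb (9 * p) x)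
    {ιt : Type} [Fintype ιt] (t : ιt → absoluteGaloisGroup K)
    (ht : Function.Bijective fun i ↦ (t i : absoluteGaloisGroup K ⧸ N₀)) :
    ∃ (Pt : ℕ → geomPoints ((cubeSumCurve 9).baseChange K))
      (cA : ℕ → galH1Torsion ((cubeSumCurve (3 * (p : ℚ) ^ 2)).baseChange K) ((2 ^ κ * 2 ^ κ : ℕ) : ℤ))
      (cB : ℕ → galH1Torsion ((cubeSumCurve (p : ℚ)).baseChange K) ((2 ^ κ * 2 ^ κ : ℕ) : ℤ)),
      -- the derived points
      (∀ n, Pt n = κ₉.symm (ιe n (((n.primeFactors.sort (· ≤ ·)).map fun q ↦ (σ n q, q)).foldr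
        (fun b z ↦ KolyvaginOperator.derivOp (pointGalHom (⟨0, 0, 1, 0, -1⟩ : WeierstrassCurve ℚ) (ringClassField K ι (9 * p * n))) b.1 b.2 z) (y n)))) ∧
      -- the level data at every `n ∈ KolSupp Kol`
      (∀ n, KolSupp Kol n → Pt n ∈ FixedPoints.addSubgroup (Nf (9 * p * n)) (geomPoints ((cubeSumCurve 9).baseChange K)) ∧
        (Nf (9 * p * n)).Normal ∧ (∀ h ∈ Nf (9 * p * n), (show AlgebraicClosure K ≃ₐ[K] AlgebraicClosure K from h) vB = vB) ∧
        (∀ h ∈ N₀, ∃ a ∈ FixedPoints.addSubgroup (Nf (9 * p * n)) (geomPoints ((cubeSumCurve 9).baseChange K)),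
          ((2 ^ κ * 2 ^ κ : ℕ) : ℤ) • a = h • Pt n - Pt n)) ∧
      -- the defining equations of the classes
      (∀ n, KolSupp Kol n → ∃ (hA : IsAdmissible (absoluteGaloisGroup K)
          ((FixedPoints.addSubgroup (Nf (9 * p * n)) (geomPoints ((cubeSumCurve 9).baseChange K))).map ψA.toAddMonoidHom) ((2 ^ κ * 2 ^ κ : ℕ) : ℤ))
        (hP : ψA (∑ i, ρ (t i) (ρ (t i) (t i • Pt n))) ∈ invPoints (absoluteGaloisGroup K)
          ((FixedPoints.addSubgroup (Nf (9 * p * n)) (geomPoints ((cubeSumCurve 9).baseChange K))).map ψA.toAddMonoidHom) ((2 ^ κ * 2 ^ κ : ℕ) : ℤ)),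
        cA n = kolyvaginClass ((cubeSumCurve (3 * (p : ℚ) ^ 2)).baseChange K) ((2 ^ κ * 2 ^ κ : ℕ) : ℤ)
          (((cubeSumCurve (3 * (p : ℚ) ^ 2)).baseChange K).zsmul_geomPoints_surjective_of_charZero
            (Int.natCast_ne_zero.mpr (mul_ne_zero (pow_ne_zero κ two_ne_zero) (pow_ne_zero κ two_ne_zero))))
          hA (ψA (∑ i, ρ (t i) (ρ (t i) (t i • Pt n)))) hP) ∧
      (∀ n, KolSupp Kol n → n ≠ 1 → ∃ (hA : IsAdmissible (absoluteGaloisGroup K)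
          ((FixedPoints.addSubgroup (Nf (9 * p * n)) (geomPoints ((cubeSumCurve 9).baseChange K))).map ψB.toAddMonoidHom) ((2 ^ κ * 2 ^ κ : ℕ) : ℤ))
        (hP : ψB (∑ i, ρ (t i) (t i • Pt n)) ∈ invPoints (absoluteGaloisGroup K)
          ((FixedPoints.addSubgroup (Nf (9 * p * n)) (geomPoints ((cubeSumCurve 9).baseChange K))).map ψB.toAddMonoidHom) ((2 ^ κ * 2 ^ κ : ℕ) : ℤ)),
        cB n = kolyvaginClass ((cubeSumCurve (p : ℚ)).baseChange K) ((2 ^ κ * 2 ^ κ : ℕ) : ℤ)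
          (((cubeSumCurve (p : ℚ)).baseChange K).zsmul_geomPoints_surjective_of_charZero
            (Int.natCast_ne_zero.mpr (mul_ne_zero (pow_ne_zero κ two_ne_zero) (pow_ne_zero κ two_ne_zero))))
          hA (ψB (∑ i, ρ (t i) (t i • Pt n))) hP) ∧
      -- l.79c
      cB 1 = ((2 : ℤ) ^ M₀) • kummerMapTorsion ((cubeSumCurve (p : ℚ)).baseChange K) ((2 ^ κ * 2 ^ κ : ℕ) : ℤ)
        (((cubeSumCurve (p : ℚ)).baseChange K).zsmul_geomPoints_surjective_of_charZero
          (Int.natCast_ne_zero.mpr (mul_ne_zero (pow_ne_zero κ two_ne_zero) (pow_ne_zero κ two_ne_zero)))) x₀ ∧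
      -- l.74
      (∀ ℓ, Kol ℓ → ℓ.Prime ∧ (Ideal.span {(ℓ : 𝓞 K)}).IsPrime) ∧
      -- l.100–111 (Selmer away from `λ` and the places over `m`)
      (∀ ℓ m : ℕ, Kol ℓ → KolSupp Kol (ℓ * m) → ¬ ℓ ∣ m →
        ∀ v₀ : HeightOneSpectrum (𝓞 K), (ℓ : 𝓞 K) ∈ v₀.asIdeal →
        ∀ v : Place K, v ≠ Sum.inr v₀ →
          (∀ q : HeightOneSpectrum (𝓞 K), (∃ r ∈ m.primeFactors, (r : 𝓞 K) ∈ q.asIdeal) → v ≠ Sum.inr q) →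
          cA (ℓ * m) ∈ selmerLocalKer ((cubeSumCurve (3 * (p : ℚ) ^ 2)).baseChange K) (Place.Completion v) ((2 ^ κ * 2 ^ κ : ℕ) : ℤ)) ∧
      (∀ ℓ m : ℕ, Kol ℓ → KolSupp Kol (ℓ * m) → ¬ ℓ ∣ m →
        ∀ v₀ : HeightOneSpectrum (𝓞 K), (ℓ : 𝓞 K) ∈ v₀.asIdeal →
        ∀ v : Place K, v ≠ Sum.inr v₀ →
          (∀ q : HeightOneSpectrum (𝓞 K), (∃ r ∈ m.primeFactors, (r : 𝓞 K) ∈ q.asIdeal) → v ≠ Sum.inr q) →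
          cB (ℓ * m) ∈ selmerLocalKer ((cubeSumCurve (p : ℚ)).baseChange K) (Place.Completion v) ((2 ^ κ * 2 ^ κ : ℕ) : ℤ)) ∧
      -- l.113–120 (the Kolyvagin primes' level)
      (∀ r : ℕ, Kol r → ∀ q : HeightOneSpectrum (𝓞 K), (r : 𝓞 K) ∈ q.asIdeal →
        ∀ (g : absoluteGaloisGroup (Place.Completion (Sum.inr q : Place K)))
          (Q : geomTorsion ((cubeSumCurve (3 * (p : ℚ) ^ 2)).baseChange K) ((2 ^ κ * 2 ^ κ : ℕ) : ℤ)),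
          absGaloisRestrict K (Place.Completion (Sum.inr q : Place K)) g • Q = Q) ∧
      (∀ r : ℕ, Kol r → ∀ q : HeightOneSpectrum (𝓞 K), (r : 𝓞 K) ∈ q.asIdeal →
        ∀ (g : absoluteGaloisGroup (Place.Completion (Sum.inr q : Place K)))
          (Q : geomTorsion ((cubeSumCurve (p : ℚ)).baseChange K) ((2 ^ κ * 2 ^ κ : ℕ) : ℤ)),
          absGaloisRestrict K (Place.Completion (Sum.inr q : Place K)) g • Q = Q) := by
  have hK := JZero.isImaginaryQuadratic_of_sq_add_self_add_one hω h2
  have hp3 : p % 3 = 1 := by omega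
  have hp0 : p ≠ 0 := hp.ne_zero
  have hp0' : (p : ℚ) ≠ 0 := by exact_mod_cast hp0
  have hp2 : p ≠ 2 := by rintro rfl; norm_num at h9
  have hp3ne : p ≠ 3 := by rintro rfl; norm_num at h9
  have h9p : 9 * p ≠ 0 := mul_ne_zero (by norm_num) hp0
  haveI := isElliptic_sylvesterNineMinimal
  haveI := isGloballyMinimal_sylvesterNineMinimal
  haveI hBellQ : (cubeSumCurve (p : ℚ)).IsElliptic := by
    have h := isElliptic_cubeSumCurve_baseChange ℚ hp0'
    rwa [WeierstrassCurve.baseChange, Algebra.algebraMap_self, WeierstrassCurve.map_id] at h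
  have hlev : 2 ^ κ * 2 ^ κ = 2 ^ (2 * κ) := by rw [two_mul, pow_add]
  -- ### what `Kol q` gives for a prime `q`
  have hKolq : ∀ q, Kol q → q.Prime ∧ q % 3 = 2 ∧ q ≠ 2 ∧ ¬ q ∣ 9 * p ∧ (Ideal.span {(q : 𝓞 K)}).IsPrime ∧
      2 ^ (2 * κ) ∣ q + 1 := by
    intro q hq
    obtain ⟨hqp, hqA, hqB, hqd, hq2, hqP, -, hFB, -⟩ := (hKol q).mp hq
    have hFB2 : FrobEqFrobInfty (cubeSumCurve (p : ℚ)) K 2 q :=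
      FrobEqFrobInfty.of_dvd (W := cubeSumCurve (p : ℚ)) (K := K) ((dvd_pow_self 2 (by omega : κ ≠ 0)).mul_right _) hFB
    obtain ⟨hq3, hqp'⟩ := mod_three_eq_two_of_clause hω h2 hp hp3 hqp hqd hFB2
    have hq9p : ¬ q ∣ 9 * p := fun h ↦ by
      rcases (Nat.Prime.dvd_mul hqp).mp h with h9 | h'
      · have : q ∣ 3 := hqp.dvd_of_dvd_pow (by norm_num at h9 ⊢; exact h9 : q ∣ 3 ^ 2)
        have := (Nat.prime_dvd_prime_iff_eq hqp Nat.prime_three).mp this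
        omega
      · exact hqp' h'
    have hkol : IsKolyvaginPrime NB (cubeSumCurve (p : ℚ)) K 2 q :=
      ⟨hqp, hqB, hqd, hq2, hqP, hFB2⟩
    have hdvd := (IsKolyvaginPrime.pow_dvd_add_one (cubeSumCurve (p : ℚ)) Nat.prime_two hkol (M := 2 * κ) (by omega) (hlev ▸ hFB)).1
    exact ⟨hqp, hq3, hq2, hq9p, hqP, Int.natCast_dvd_natCast.mp (by exact_mod_cast hdvd)⟩
  -- ### the lists of generators and their properties at `n ∈ KolSupp Kol`
  have hlist : ∀ n, KolSupp Kol n →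
      (∀ a ∈ ((n.primeFactors.sort (· ≤ ·)).map fun q ↦ (σ n q, q)), a.2 ∈ n.primeFactors) ∧
      (∀ q ∈ n.primeFactors, ∃ a ∈ ((n.primeFactors.sort (· ≤ ·)).map fun q ↦ (σ n q, q)), a.2 = q) ∧
      (∀ a ∈ ((n.primeFactors.sort (· ≤ ·)).map fun q ↦ (σ n q, q)), a.2 % 3 = 2) ∧
      (∀ a ∈ ((n.primeFactors.sort (· ≤ ·)).map fun q ↦ (σ n q, q)), a.2 ≠ 2) ∧
      (∀ a ∈ ((n.primeFactors.sort (· ≤ ·)).map fun q ↦ (σ n q, q)),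
        Subgroup.zpowers a.1 = ringClassGalOver ι (9 * p * n) (9 * p * n / a.2)) ∧
      (∀ a ∈ ((n.primeFactors.sort (· ≤ ·)).map fun q ↦ (σ n q, q)), 2 ^ (2 * κ) ∣ a.2 + 1) := by
    rintro n ⟨hsq, hkol⟩
    have hmem : ∀ a ∈ ((n.primeFactors.sort (· ≤ ·)).map fun q ↦ (σ n q, q)), a.2 ∈ n.primeFactors ∧ a = (σ n a.2, a.2) := by
      intro a ha
      obtain ⟨q, hq, rfl⟩ := List.mem_map.mp ha
      exact ⟨(Finset.mem_sort _).mp hq, rfl⟩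
    refine ⟨fun a ha ↦ (hmem a ha).1, fun q hq ↦ ⟨(σ n q, q), List.mem_map.mpr ⟨q, (Finset.mem_sort _).mpr hq, rfl⟩, rfl⟩,
      fun a ha ↦ (hKolq _ (hkol _ (hmem a ha).1)).2.1, fun a ha ↦ (hKolq _ (hkol _ (hmem a ha).1)).2.2.1,
      fun a ha ↦ ?_, fun a ha ↦ (hKolq _ (hkol _ (hmem a ha).1)).2.2.2.2.2⟩
    obtain ⟨hq, e⟩ := hmem a ha
    obtain ⟨hqp, -, -, hq9p, hqP, -⟩ := hKolq _ (hkol _ hq)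
    have hqn : a.2 ∣ n := Nat.dvd_of_mem_primeFactors hq
    have hqn' : ¬ a.2 ∣ n / a.2 := fun h' ↦
      hqp.one_lt.ne' (Nat.isUnit_iff.mp (hsq _ (Nat.mul_dvd_of_dvd_div hqn h')))
    rw [e]
    exact hσgen n a.2 hsq.ne_zero hqp hq9p hqP hqn hqn'
  -- ### the level data at every `n ∈ KolSupp Kol`
  have LD := fun n (h : KolSupp Kol n) ↦
    levelData_sylvesterTower hω h2 ι Dt hp hp3 h.1 (rfl : 9 * p * n = 9 * p * n) κ₉ hκG hvBc hvB hvAc hvA0 hvB3 hvA3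
      hρ hρρ hlawB hlawA (emb (9 * p)) (hemb _) N₀ hN₀ t ht
      (ringClassField_mono hK ι (dvd_mul_right (9 * p) n) (mul_ne_zero h9p h.1.ne_zero)) (emb (9 * p * n)) (hemb _)
      (fun x ↦ hcoh _ _ _ x) (ιe n) (hιe n) (Nf (9 * p * n)) (hNf _) _ (hlist n h).1 (hlist n h).2.1
      (hlist n h).2.2.1 (hlist n h).2.2.2.1 (hlist n h).2.2.2.2.1 (2 ^ κ * 2 ^ κ) hlev (hlist n h).2.2.2.2.2
      (hy n h.1.ne_zero fun q hq ↦ (hKolq q (h.2 q hq)).2.1)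
  -- ### the classes
  refine ⟨fun n ↦ κ₉.symm (ιe n (((n.primeFactors.sort (· ≤ ·)).map fun q ↦ (σ n q, q)).foldr
      (fun b z ↦ KolyvaginOperator.derivOp (pointGalHom (⟨0, 0, 1, 0, -1⟩ : WeierstrassCurve ℚ) (ringClassField K ι (9 * p * n))) b.1 b.2 z) (y n))),
    fun n ↦ if h : KolSupp Kol n then
      kolyvaginClass ((cubeSumCurve (3 * (p : ℚ) ^ 2)).baseChange K) ((2 ^ κ * 2 ^ κ : ℕ) : ℤ)
        (((cubeSumCurve (3 * (p : ℚ) ^ 2)).baseChange K).zsmul_geomPoints_surjective_of_charZero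
          (Int.natCast_ne_zero.mpr (mul_ne_zero (pow_ne_zero κ two_ne_zero) (pow_ne_zero κ two_ne_zero)))) (LD n h).2.2.2.2.2.2.2.2.2.2.1 _
        (LD n h).2.2.2.2.2.2.2.2.2.2.2.2 else 0,
    fun n ↦ if h1 : n = 1 then ((2 : ℤ) ^ M₀) • kummerMapTorsion ((cubeSumCurve (p : ℚ)).baseChange K) ((2 ^ κ * 2 ^ κ : ℕ) : ℤ)
        (((cubeSumCurve (p : ℚ)).baseChange K).zsmul_geomPoints_surjective_of_charZero
          (Int.natCast_ne_zero.mpr (mul_ne_zero (pow_ne_zero κ two_ne_zero) (pow_ne_zero κ two_ne_zero)))) x₀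
      else if h : KolSupp Kol n then
      kolyvaginClass ((cubeSumCurve (p : ℚ)).baseChange K) ((2 ^ κ * 2 ^ κ : ℕ) : ℤ)
        (((cubeSumCurve (p : ℚ)).baseChange K).zsmul_geomPoints_surjective_of_charZero
          (Int.natCast_ne_zero.mpr (mul_ne_zero (pow_ne_zero κ two_ne_zero) (pow_ne_zero κ two_ne_zero)))) (LD n h).2.2.2.2.2.2.2.2.2.1 _
        (LD n h).2.2.2.2.2.2.2.2.2.2.2.1 else 0,
    fun n ↦ rfl, fun n h ↦ ⟨(LD n h).2.2.2.1, (LD n h).2.2.2.2.2.1, (LD n h).2.2.2.2.2.2.2.2.1, (LD n h).2.2.2.2.1⟩,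
    fun n h ↦ ⟨(LD n h).2.2.2.2.2.2.2.2.2.2.1, (LD n h).2.2.2.2.2.2.2.2.2.2.2.2, by simp only [dif_pos h]⟩,
    fun n h h1 ↦ ⟨(LD n h).2.2.2.2.2.2.2.2.2.1, (LD n h).2.2.2.2.2.2.2.2.2.2.2.1, by simp only [dif_neg h1, dif_pos h]⟩,
    dif_pos rfl, fun ℓ hℓ ↦ ⟨(hKolq ℓ hℓ).1, (hKolq ℓ hℓ).2.2.2.2.1⟩, ?_, ?_, ?_, ?_⟩
  · -- Selmer-away for `c_A(ℓm)` ((T8) at the conductor `9p(ℓm)`)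
    intro ℓ m hℓ hℓm hℓm' v₀ hv₀ v hv hvq
    have h := hℓm
    simp only [dif_pos h]
    obtain ⟨hℓp, -, -, -, hℓP, -⟩ := hKolq ℓ hℓ
    haveI : (Nf (9 * p * (ℓ * m))).Normal := (LD _ h).2.2.2.2.2.1
    have hQN := chiComponent_mem (fun g ↦ ((ρ g).trans (ρ g)).toAddMonoidHom)
      (fun g _ ha ↦ JZero.smul_mem_fixedPoints _ (Nf (9 * p * (ℓ * m))) g ha)
      (fun g _ ha ↦ JZero.rho_mem_fixedPoints _ hω hvB hvB3 hρ (Nf (9 * p * (ℓ * m))) g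
        (JZero.rho_mem_fixedPoints _ hω hvB hvB3 hρ (Nf (9 * p * (ℓ * m))) g ha)) t (LD _ h).2.2.2.1
    have hNle : Nf (9 * p * (ℓ * m)) ≤ N₀ := fun g hg ↦ (hN₀ g).mpr fun x ↦ by
      rw [← hcoh _ _ (ringClassField_mono hK ι (dvd_mul_right (9 * p) (ℓ * m)) (mul_ne_zero h9p h.1.ne_zero)) x]
      exact (hNf _ g).mp hg _
    refine selmerAway_of_recipe_three_mul_sq hω h2 hp hp2 hp3ne (2 ^ κ * 2 ^ κ) hlev h.1.ne_zero ι (emb _) (hemb _)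
      (Nf _) (hNf _) hψA (fun g hg ↦ (LD _ h).2.2.2.2.2.2.2.1 g (hNle hg)) (LD _ h).2.2.2.2.2.2.2.2.2.2.1 hQN
      (LD _ h).2.2.2.2.2.2.2.2.2.2.2.2 v fun q ⟨r, hr, hrq⟩ ↦ ?_
    rw [Nat.primeFactors_mul hℓp.ne_zero (fun hm ↦ h.1.ne_zero (by rw [hm, mul_zero])), Finset.mem_union,
      hℓp.primeFactors, Finset.mem_singleton] at hr
    rcases hr with rfl | hr
    · have hq : q = v₀ := HeightOneSpectrum.ext (by rw [asIdeal_eq_span_of_mem hℓp hℓP hrq, asIdeal_eq_span_of_mem hℓp hℓP hv₀])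
      rw [hq]; exact hv
    · exact hvq q ⟨r, hr, hrq⟩
  · -- Selmer-away for `c_B(ℓm)`
    intro ℓ m hℓ hℓm hℓm' v₀ hv₀ v hv hvq
    have h := hℓm
    obtain ⟨hℓp, -, -, -, hℓP, -⟩ := hKolq ℓ hℓ
    have h1 : ℓ * m ≠ 1 := fun e ↦ hℓp.one_lt.ne' (Nat.eq_one_of_mul_eq_one_right e)
    simp only [dif_neg h1, dif_pos h]
    haveI : (Nf (9 * p * (ℓ * m))).Normal := (LD _ h).2.2.2.2.2.1
    have hQN := chiComponent_mem (fun g ↦ (ρ g).toAddMonoidHom)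
      (fun g _ ha ↦ JZero.smul_mem_fixedPoints _ (Nf (9 * p * (ℓ * m))) g ha)
      (fun g _ ha ↦ JZero.rho_mem_fixedPoints _ hω hvB hvB3 hρ (Nf (9 * p * (ℓ * m))) g ha) t (LD _ h).2.2.2.1
    refine selmerAway_of_recipe_prime hω h2 hp h9 (2 ^ κ * 2 ^ κ) hlev h.1.ne_zero ι (emb _) (hemb _)
      (Nf _) (hNf _) hψB (LD _ h).2.2.2.2.2.2.2.2.1 (LD _ h).2.2.2.2.2.2.2.2.2.1 hQN
      (LD _ h).2.2.2.2.2.2.2.2.2.2.2.1 v fun q ⟨r, hr, hrq⟩ ↦ ?_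
    rw [Nat.primeFactors_mul hℓp.ne_zero (fun hm ↦ h.1.ne_zero (by rw [hm, mul_zero])), Finset.mem_union,
      hℓp.primeFactors, Finset.mem_singleton] at hr
    rcases hr with rfl | hr
    · have hq : q = v₀ := HeightOneSpectrum.ext (by rw [asIdeal_eq_span_of_mem hℓp hℓP hrq, asIdeal_eq_span_of_mem hℓp hℓP hv₀])
      rw [hq]; exact hv
    · exact hvq q ⟨r, hr, hrq⟩
  · exact fun r hr ↦ (kolyvaginLevel_trivial_sylvesterPair hω h2 hp hp3 κ hκ hNA b₀).1 r ((hKol r).mp hr)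
  · exact fun r hr ↦ (kolyvaginLevel_trivial_sylvesterPair hω h2 hp hp3 κ hκ hNA b₀).2 r ((hKol r).mp hr)

end Summit.BirchSwinnertonDyer.BirchSwinnertonDyer.Theorems.SylvesterTwoCMFlip

end
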